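/-
PORT (pub-hodgecm2 COR-CM cell, count-neutral lane PERL34-DISCHARGE, seat prover-pub-hodgecm2-b26-g22-0, 2026-08-21) of the stage-1 package
file `HodgeCMPerL/HodgeCM/Prior/Perl34.lean` (md5 a2455d388f0d, 1862 l.), SECTION C4 = its ll. 945–1328: [PerL] v5 Lemma 4.2(b) (lem:chars,
tex ll. 526–636), the RALLIS POSITIVITY CHAIN over the interface of the tree's `Perl34IsolationSetting.lean` (p277216) — split unramified
Euler factor `eulerFactor` (Laurent expansion, positivity, log bound), exp/log bridge `hasProd_of_summable_log`, the interface
`C4.RallisDatum` (Rallis inner product formula in Weil's convergent range as FIELDS) with `innerSelf_pos`, the per-side package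
`C4.CharsDischarge D V` with `θvec_ne_zero` and `H_chars : ∀ χ, D.allowed χ` = the frozen hypothesis `IsolationSetting.H_chars12/34` of
PerL Prop 3.6 ∕ Thm 3.7 (p277743).  Declarations/proofs VERBATIM; edits: header, import, namespace token `HodgeCM.Prior.Perl34File` ↦
`Summit.HodgeConjecture.CorCM.Prior.Perl34File`, one linter fix (unused binder `i` ↦ `_` in `summable_of_abs_le_mul`).  Completes tr-prover-5's
port of the same file (item (v) of rfwf v3 §4.2); package consumers: `Automorphic/CharsOccJoin.lean`, `PerL34/Chars.lean`,
`PerL34/EulerProduct.lean` (`toRallisDatum`).  HONESTY NOTE (package): the bridge field `allowed_of_theta` carries the lemma's residual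
content.  FRAMING: HC_CM is NOT proved; abstract Hilbert-space data and real series only, no model.
-/
import Summits.HodgeConjecture.CorCM.Prior.Perl34IsolationSetting

namespace Summit.HodgeConjecture.CorCM.Prior.Perl34File
/-! # C4 = Lemma 4.2 (lem:chars, [PerL] v5 ll. 526–636) — the Rallis positivity chain

S4 tranche, second target (plan v2 @e3be098b, "C3a + C4" row; hunt (vi) modulo AX7's
print content).  Byte-identical prefix = C3a_Bridge.lean (itself IsolationSetting
@2def0917 ++ C3a; `cmp`-verified in S4/README.md).

Structure fields = the axiom-group content as consumed (AX6, AX7 + orientation pin,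
AX10, AX1b(d), the A4-discharged ramified positivity, the A#11 named summability);
PROVED here (plan A5 + the lem:chars(b) logic): the split unramified Euler factor
Σ_{n∈ℤ} t^{|n|} a^n = (1−t²)/|1−at|² > 0 (t = q^{−3/2}), the exp/log
absolute-convergence bridge HasProd f (exp Σ log f) with its positivity, the
per-place positivity of the unramified tail, ⟨θ_φ(χ′),θ_φ(χ′)⟩ > 0, θ ≠ 0, and the
discharge of the frozen `H_chars` hypothesis (every χ ∈ X allowed). -/
namespace Perl34
namespace C4

open Complex
/-! ## Plan A5, first half: the split unramified Euler factor (ll. 629–631) -/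

/-- The closed form (1−t²)/|1−at|² of the split unramified local factor
I_v(φ⁰_v) = Σ_{n∈ℤ} q_v^{−3|n|/2} a_v^n, with t = q_v^{−3/2} (l. 629–631). -/
noncomputable def eulerFactor (t : ℝ) (a : ℂ) : ℝ :=
  (1 - t ^ 2) / Complex.normSq (1 - a * t)

/-- (no docstring in the 2001 source) -/
theorem norm_mul_ofReal {a : ℂ} (ha : ‖a‖ = 1) {t : ℝ} (ht0 : 0 ≤ t) :
    ‖a * (t : ℂ)‖ = t := by
  rw [norm_mul, ha, one_mul, Complex.norm_real, Real.norm_eq_abs, abs_of_nonneg ht0]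

/-- (no docstring in the 2001 source) -/
theorem one_sub_mul_ne_zero {t : ℝ} (ht0 : 0 ≤ t) (ht1 : t < 1) {a : ℂ} (ha : ‖a‖ = 1) :
    (1 : ℂ) - a * t ≠ 0 := by
  intro h
  have h1 : a * (t : ℂ) = 1 := (sub_eq_zero.mp h).symm
  have h2 : ‖a * (t : ℂ)‖ = t := norm_mul_ofReal ha ht0
  rw [h1, norm_one] at h2
  linarith

/-- (no docstring in the 2001 source) -/
theorem eulerFactor_pos {t : ℝ} (ht0 : 0 ≤ t) (ht1 : t < 1) {a : ℂ} (ha : ‖a‖ = 1) :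
    0 < eulerFactor t a := by
  apply div_pos
  · nlinarith
  · exact Complex.normSq_pos.mpr (one_sub_mul_ne_zero ht0 ht1 ha)

/-- **The A5 identity** ([PerL] l. 629–631): Σ_{n∈ℤ} t^{|n|} aⁿ = (1−t²)/|1−at|² for
|a| = 1 and 0 ≤ t < 1 — two geometric series glued over ℤ, with a⁻¹ = ā. -/
theorem hasSum_eulerFactor {t : ℝ} (ht0 : 0 ≤ t) (ht1 : t < 1) {a : ℂ} (ha : ‖a‖ = 1) :
    HasSum (fun n : ℤ => (t : ℂ) ^ n.natAbs * a ^ n) ((eulerFactor t a : ℝ) : ℂ) := by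
  have hA : (1 : ℂ) - a * t ≠ 0 := one_sub_mul_ne_zero ht0 ht1 ha
  have hconj : (starRingEnd ℂ) ((1 : ℂ) - a * t) = 1 - (starRingEnd ℂ) a * t := by
    simp [map_sub, map_mul, Complex.conj_ofReal]
  have hB : (1 : ℂ) - (starRingEnd ℂ) a * t ≠ 0 := by
    intro h
    apply hA
    have h2 := congrArg (starRingEnd ℂ) h
    rw [map_zero, map_sub, map_one, map_mul, Complex.conj_conj, Complex.conj_ofReal] at h2
    exact h2
  have hna : ‖a * (t : ℂ)‖ < 1 := by rw [norm_mul_ofReal ha ht0]; exact ht1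
  have hac : ‖(starRingEnd ℂ) a‖ = 1 := by rw [RCLike.norm_conj]; exact ha
  have hnc : ‖(starRingEnd ℂ) a * (t : ℂ)‖ < 1 := by
    rw [norm_mul_ofReal hac ht0]; exact ht1
  have ha0 : a ≠ 0 := by intro h; rw [h, norm_zero] at ha; norm_num at ha
  have haa : a * (starRingEnd ℂ) a = 1 := by
    rw [← Complex.inv_eq_conj ha, mul_inv_cancel₀ ha0]
  -- the two geometric halves
  have h1 : HasSum (fun n : ℕ => (t : ℂ) ^ ((n : ℤ)).natAbs * a ^ (n : ℤ))
      ((1 - a * t)⁻¹) := by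
    have he : (fun n : ℕ => (t : ℂ) ^ ((n : ℤ)).natAbs * a ^ (n : ℤ))
        = fun n : ℕ => (a * (t : ℂ)) ^ n := by
      funext n
      have hn : ((n : ℤ)).natAbs = n := by omega
      rw [hn, zpow_natCast, mul_pow]
      ring
    rw [he]
    exact hasSum_geometric_of_norm_lt_one hna
  have h2 : HasSum (fun n : ℕ => (t : ℂ) ^ ((-((n : ℤ) + 1))).natAbs * a ^ (-((n : ℤ) + 1)))
      (((starRingEnd ℂ) a * t) * (1 - (starRingEnd ℂ) a * t)⁻¹) := by
    have he : (fun n : ℕ => (t : ℂ) ^ ((-((n : ℤ) + 1))).natAbs * a ^ (-((n : ℤ) + 1)))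
        = fun n : ℕ => ((starRingEnd ℂ) a * (t : ℂ)) * ((starRingEnd ℂ) a * (t : ℂ)) ^ n := by
      funext n
      have hn : ((-((n : ℤ) + 1))).natAbs = n + 1 := by omega
      have hz : a ^ (-((n : ℤ) + 1)) = ((starRingEnd ℂ) a) ^ (n + 1) := by
        rw [zpow_neg, ← Complex.inv_eq_conj ha, inv_pow]
        norm_cast
      rw [hn, hz]
      ring
    rw [he]
    exact (hasSum_geometric_of_norm_lt_one hnc).mul_left _
  have hsum := HasSum.of_nat_of_neg_add_one
    (f := fun n : ℤ => (t : ℂ) ^ n.natAbs * a ^ n) h1 h2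
  -- identify the value
  have hnum : ((1 : ℂ) - (starRingEnd ℂ) a * t) + ((starRingEnd ℂ) a * t) * ((1 : ℂ) - a * t)
      = 1 - (t : ℂ) ^ 2 := by linear_combination (-(t : ℂ) ^ 2) * haa
  have hABconj : ((1 : ℂ) - a * t) * ((1 : ℂ) - (starRingEnd ℂ) a * t)
      = ((Complex.normSq ((1 : ℂ) - a * t) : ℝ) : ℂ) := by
    rw [← hconj, Complex.mul_conj]
  have id1 : (1 - a * (t : ℂ))⁻¹
        + ((starRingEnd ℂ) a * t) * (1 - (starRingEnd ℂ) a * (t : ℂ))⁻¹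
      = (((1 : ℂ) - (starRingEnd ℂ) a * t) + ((starRingEnd ℂ) a * t) * ((1 : ℂ) - a * t))
        / (((1 : ℂ) - a * t) * ((1 : ℂ) - (starRingEnd ℂ) a * t)) := by
    rw [eq_div_iff (mul_ne_zero hA hB), add_mul]
    have e1 : ((1 : ℂ) - a * t)⁻¹ * (((1 : ℂ) - a * t) * ((1 : ℂ) - (starRingEnd ℂ) a * t))
        = (1 : ℂ) - (starRingEnd ℂ) a * t := by
      rw [← mul_assoc, inv_mul_cancel₀ hA, one_mul]
    have e2 : ((starRingEnd ℂ) a * (t : ℂ)) * ((1 : ℂ) - (starRingEnd ℂ) a * t)⁻¹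
          * (((1 : ℂ) - a * t) * ((1 : ℂ) - (starRingEnd ℂ) a * t))
        = ((starRingEnd ℂ) a * t) * ((1 : ℂ) - a * t) := by
      calc ((starRingEnd ℂ) a * (t : ℂ)) * ((1 : ℂ) - (starRingEnd ℂ) a * t)⁻¹
            * (((1 : ℂ) - a * t) * ((1 : ℂ) - (starRingEnd ℂ) a * t))
          = ((starRingEnd ℂ) a * (t : ℂ)) * ((1 : ℂ) - a * t)
            * (((1 : ℂ) - (starRingEnd ℂ) a * t)⁻¹ * ((1 : ℂ) - (starRingEnd ℂ) a * t)) := by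
            ring
        _ = ((starRingEnd ℂ) a * t) * ((1 : ℂ) - a * t) := by
            rw [inv_mul_cancel₀ hB, mul_one]
    rw [e1, e2]
  have hval : (1 - a * (t : ℂ))⁻¹
        + ((starRingEnd ℂ) a * t) * (1 - (starRingEnd ℂ) a * (t : ℂ))⁻¹
      = ((eulerFactor t a : ℝ) : ℂ) := by
    rw [id1, hnum, hABconj, eulerFactor]
    push_cast
    ring
  rw [hval] at hsum
  exact hsum

/-- The tsum form of the A5 identity. -/
theorem tsum_eulerFactor {t : ℝ} (ht0 : 0 ≤ t) (ht1 : t < 1) {a : ℂ} (ha : ‖a‖ = 1) :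
    ∑' n : ℤ, (t : ℂ) ^ n.natAbs * a ^ n = ((eulerFactor t a : ℝ) : ℂ) :=
  (hasSum_eulerFactor ht0 ht1 ha).tsum_eq

/-- Consumer form: a real number equal (in ℂ) to the split unramified series is the
Euler value — the shape in which `RallisDatum` evaluates its tail factors. -/
theorem eq_eulerFactor_of_ofReal_eq_tsum {t : ℝ} (ht0 : 0 ≤ t) (ht1 : t < 1) {a : ℂ}
    (ha : ‖a‖ = 1) {I : ℝ} (h : (I : ℂ) = ∑' n : ℤ, (t : ℂ) ^ n.natAbs * a ^ n) :
    I = eulerFactor t a := by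
  rw [tsum_eulerFactor ht0 ht1 ha] at h
  exact_mod_cast h

/-! ## Plan A5, second half: absolute convergence ⇒ the tail product is positive -/

/-- The elementary exp/log bridge: strictly positive factors with summable logs have
the product exp(Σ log) — the partial products are exp of the partial sums, and exp
is continuous.  (Consumed with `HasProd.unique` against the AX7 tail field.) -/
theorem hasProd_of_summable_log {ι : Type} {f : ι → ℝ} (hf : ∀ i, 0 < f i)
    (h : Summable fun i => Real.log (f i)) :
    HasProd f (Real.exp (∑' i, Real.log (f i))) := by
  have hs : HasSum (fun i => Real.log (f i)) (∑' i, Real.log (f i)) := h.hasSum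
  have hexp := (Real.continuous_exp.tendsto _).comp hs
  have hcongr : ∀ s : Finset ι,
      Real.exp (∑ i ∈ s, Real.log (f i)) = ∏ i ∈ s, f i := by
    intro s
    rw [Real.exp_sum]
    exact Finset.prod_congr rfl fun i _ => Real.exp_log (hf i)
  exact hexp.congr hcongr

/-- Positivity of any HasProd limit of positive factors with summable logs. -/
theorem pos_of_hasProd_of_summable_log {ι : Type} {f : ι → ℝ} {P : ℝ}
    (hf : ∀ i, 0 < f i) (h : Summable fun i => Real.log (f i)) (hP : HasProd f P) :
    0 < P := by
  have hu := (hasProd_of_summable_log hf h).unique hP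
  rw [← hu]
  exact Real.exp_pos _

/-- |log(eulerFactor t a)| ≤ 4t for 0 ≤ t ≤ 1/2 — the comparison that turns the A#11
summability Σ t_v < ∞ into summability of the log series (t_v = q_v^{−3/2} ≤ 2^{−3/2}
< 1/2 at every finite place). -/
theorem abs_log_eulerFactor_le {t : ℝ} (ht0 : 0 ≤ t) (ht : t ≤ 1 / 2) {a : ℂ}
    (ha : ‖a‖ = 1) : |Real.log (eulerFactor t a)| ≤ 4 * t := by
  have ht1 : t < 1 := by linarith
  have h1t : (0 : ℝ) < 1 - t := by linarith
  have h1t' : (0 : ℝ) < 1 + t := by linarith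
  have hef : 0 < eulerFactor t a := eulerFactor_pos ht0 ht1 ha
  have hat : ‖a * (t : ℂ)‖ = t := norm_mul_ofReal ha ht0
  have hlo : 1 - t ≤ ‖(1 : ℂ) - a * t‖ := by
    have h₁ := norm_sub_norm_le (1 : ℂ) (a * t)
    rw [norm_one, hat] at h₁
    exact h₁
  have hhi : ‖(1 : ℂ) - a * t‖ ≤ 1 + t := by
    have h₁ := norm_sub_le (1 : ℂ) (a * t)
    rw [norm_one, hat] at h₁
    exact h₁
  have hnq : Complex.normSq ((1 : ℂ) - a * t) = ‖(1 : ℂ) - a * t‖ ^ 2 :=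
    Complex.normSq_eq_norm_sq _
  have hsq_lo : (1 - t) ^ 2 ≤ Complex.normSq ((1 : ℂ) - a * t) := by
    rw [hnq]; exact pow_le_pow_left₀ h1t.le hlo 2
  have hsq_hi : Complex.normSq ((1 : ℂ) - a * t) ≤ (1 + t) ^ 2 := by
    rw [hnq]; exact pow_le_pow_left₀ (norm_nonneg _) hhi 2
  have hnq_pos : 0 < Complex.normSq ((1 : ℂ) - a * t) :=
    Complex.normSq_pos.mpr (one_sub_mul_ne_zero ht0 ht1 ha)
  have hef_hi : eulerFactor t a ≤ (1 + t) / (1 - t) := by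
    rw [eulerFactor, div_le_div_iff₀ hnq_pos h1t]
    nlinarith [mul_le_mul_of_nonneg_left hsq_lo h1t'.le]
  have hef_lo : (1 - t) / (1 + t) ≤ eulerFactor t a := by
    rw [eulerFactor, div_le_div_iff₀ h1t' hnq_pos]
    nlinarith [mul_le_mul_of_nonneg_left hsq_hi h1t.le]
  have hstep : (1 + t) / (1 - t) - 1 ≤ 4 * t := by
    rw [div_sub_one h1t.ne', div_le_iff₀ h1t]
    nlinarith
  have hlog_hi : Real.log (eulerFactor t a) ≤ 4 * t := by
    have h₁ := Real.log_le_sub_one_of_pos hef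
    linarith [hef_hi]
  have hinv_hi : (eulerFactor t a)⁻¹ ≤ (1 + t) / (1 - t) := by
    have h₀ : 0 < (1 - t) / (1 + t) := div_pos h1t h1t'
    have h₁ := one_div_le_one_div_of_le h₀ hef_lo
    rw [one_div, one_div, inv_div] at h₁
    exact h₁
  have hlog_lo : -(4 * t) ≤ Real.log (eulerFactor t a) := by
    have h₁ := Real.log_le_sub_one_of_pos (inv_pos.mpr hef)
    rw [Real.log_inv] at h₁
    linarith [hinv_hi]
  rw [abs_le]
  exact ⟨by linarith, by linarith⟩

/-- Comparison summability: |g| ≤ 4t pointwise and Σt < ∞ give Σg summable. -/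
theorem summable_of_abs_le_mul {ι : Type} {g t : ι → ℝ} (hsum : Summable t)
    (h : ∀ i, |g i| ≤ 4 * t i) : Summable g :=
  Summable.of_abs
    (Summable.of_nonneg_of_le (fun _ => abs_nonneg _) h (hsum.mul_left 4))

/-! ## The Rallis datum: lem:chars(b)'s inner-product chain as an interface -/

/-- **One Rallis datum** — the inner-product chain of lem:chars(b) (ll. 548–632) for
ONE candidate datum (W_i, μ_i, χ′_i) and ONE chosen factorizable Fock–Schwartz
vector φ = ⊗φ_v, at the plan's abstraction.  `V` indexes the finite places of L₀
together with the archimedean ones (the local factors of l. 609).  Fields carry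
AX7 (+ the χ′-unconjugated orientation pin), the A#11 named summability, and the
A4/AX6-discharged ramified positivity; everything else is proved. -/
structure RallisDatum (V : Type) where
  /-- the local factors I_v(φ_v) = ∫⟨ω_v(y)φ_v, φ_v⟩ χ′_v(y) dy of the chosen φ
  (l. 609; real by positive-definiteness, l. 612). -/
  Iloc : V → ℝ
  /-- the finite exceptional set S of l. 623–629 ("Enlarging S, for v ∉ S also
  φ_v = φ⁰_v and all splitting data are unramified"), including the archimedean
  places and the non-split ramified ones. -/
  S : Finset V
  /-- t v = q_v^{−3/2} (residue field size q_v ≥ 2; meaningful at split v ∉ S). -/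
  tpar : V → ℝ
  /-- a_v = χ′_v(ϖ_v)ν_v(ϖ_v), |a_v| = 1 (l. 630–631). -/
  apar : V → ℂ
  /-- "v splits in L" (l. 610, 617, 629). -/
  IsSplit : V → Prop
  /-- the positive constant of Weil's Siegel–Weil formula (ll. 580–581, c > 0). -/
  c : ℝ
  c_pos : 0 < c
  /-- ⟨θ_φ(χ′), θ_φ(χ′)⟩ — real (it is a squared L²-norm). -/
  innerSelf : ℝ
  /-- the value of the unramified tail product Π_{v∉S} I_v(φ⁰_v) (l. 631). -/
  tail : ℝ
  /-- AX7 ([PerL] ll. 548–631; GQT §11.3, Li92 (11)–(15),(26)–(27), Weil 1965; the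
  χ′-UNCONJUGATED orientation pin of (eq:basic)/Li92 (26)): the Rallis inner-product
  factorization ⟨θ_φ(χ′),θ_φ(χ′)⟩ = c·Π_v I_v(φ_v) for the chosen φ, split as the
  finite ramified product times the tail. -/
  AX7_factor : innerSelf = c * (∏ v ∈ S, Iloc v) * tail
  /-- AX7: the unramified tail converges (multipliably) to `tail` (l. 631 "converges
  absolutely"). -/
  AX7_tail : HasProd (fun v : {w : V // w ∉ S} => Iloc v.1) tail
  /-- 0 ≤ t_v. -/
  tpar_nonneg : ∀ v : V, 0 ≤ tpar v
  /-- t_v = q_v^{−3/2} ≤ 2^{−3/2} < 1/2 (q_v ≥ 2). -/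
  tpar_le : ∀ v : V, tpar v ≤ 1 / 2
  /-- |a_v| = 1 (χ′ and ν unitary, l. 630–631). -/
  apar_norm : ∀ v : V, ‖apar v‖ = 1
  /-- A#11 NAMED INPUT (plan A5): Σ_{v∉S} q_v^{−3/2} < ∞ — A-provable by comparison
  with [L₀:ℚ]·Σ_p p^{−3/2} (Dedekind ζ at 3/2); carried as a field per the plan. -/
  A11_summable : Summable fun v : {w : V // w ∉ S} => tpar v.1
  /-- l. 629–631: at split v ∉ S the local factor is the unramified series
  Σ_{n∈ℤ} q_v^{−3|n|/2} a_vⁿ (the integral evaluated on the spherical vector; the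
  closed form is PROVED above, plan A5). -/
  AX7_split_val : ∀ v : V, v ∉ S → IsSplit v →
    (Iloc v : ℂ) = ∑' n : ℤ, (tpar v : ℂ) ^ n.natAbs * apar v ^ n
  /-- l. 629: at non-split v ∉ S, I_v(φ⁰_v) = 1 (χ′_v trivial on the full compact
  group there, ll. 623–629). -/
  AX7_nonsplit_val : ∀ v : V, v ∉ S → ¬IsSplit v → Iloc v = 1
  /-- COMPOSITE (disclosed design cut; per-place discharges): at v ∈ S the chosen φ_v
  has I_v(φ_v) > 0 — at archimedean and non-split finite v by A4's projection formula
  I_v = vol·‖φ_v[χ̄′_v]‖² (S2's `A4_positivity_named`, [A#2] orientation) with the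
  named nonzero χ̄′_v-isotypic vector (lem:arch(a) at real b; AX6/SZ conservation ⇒
  occurrence at non-split finite v, ll. 543–547, 613–617); at split v ∈ S by the
  ball computation I_v = vol(D)·vol(U₁) > 0 (ll. 617–623; plan A10's set identity). -/
  ram_pos : ∀ v ∈ S, 0 < Iloc v

namespace RallisDatum

variable {V : Type} (D : RallisDatum V)

/-- Split tail factors are the Euler values (A5 consumed against the AX7 field). -/
theorem tail_factor_eq (v : V) (hv : v ∉ D.S) (hs : D.IsSplit v) :
    D.Iloc v = eulerFactor (D.tpar v) (D.apar v) :=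
  eq_eulerFactor_of_ofReal_eq_tsum (D.tpar_nonneg v)
    (by linarith [D.tpar_le v]) (D.apar_norm v) (D.AX7_split_val v hv hs)

/-- Every unramified tail factor is positive (l. 629–631). -/
theorem tail_factor_pos (v : V) (hv : v ∉ D.S) : 0 < D.Iloc v := by
  by_cases hs : D.IsSplit v
  · rw [D.tail_factor_eq v hv hs]
    exact eulerFactor_pos (D.tpar_nonneg v) (by linarith [D.tpar_le v]) (D.apar_norm v)
  · rw [D.AX7_nonsplit_val v hv hs]
    norm_num

/-- |log I_v| ≤ 4 t_v on the tail (split: the Euler bound; non-split: log 1 = 0). -/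
theorem tail_abs_log_le (v : {w : V // w ∉ D.S}) :
    |Real.log (D.Iloc v.1)| ≤ 4 * D.tpar v.1 := by
  by_cases hs : D.IsSplit v.1
  · rw [D.tail_factor_eq v.1 v.2 hs]
    exact abs_log_eulerFactor_le (D.tpar_nonneg v.1) (D.tpar_le v.1) (D.apar_norm v.1)
  · rw [D.AX7_nonsplit_val v.1 v.2 hs, Real.log_one, abs_zero]
    have := D.tpar_nonneg v.1
    linarith

/-- The log series of the tail is summable (A#11 + the Euler bound). -/
theorem tail_log_summable :
    Summable fun v : {w : V // w ∉ D.S} => Real.log (D.Iloc v.1) :=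
  summable_of_abs_le_mul D.A11_summable D.tail_abs_log_le

/-- **The tail is positive** (l. 631 "converges absolutely to a positive number"). -/
theorem tail_pos : 0 < D.tail :=
  pos_of_hasProd_of_summable_log (f := fun v : {w : V // w ∉ D.S} => D.Iloc v.1)
    (fun v => D.tail_factor_pos v.1 v.2) D.tail_log_summable D.AX7_tail

/-- **lem:chars(b), positivity** (l. 631–632): ⟨θ_φ(χ′), θ_φ(χ′)⟩ > 0. -/
theorem innerSelf_pos : 0 < D.innerSelf := by
  rw [D.AX7_factor]
  exact mul_pos (mul_pos D.c_pos (Finset.prod_pos fun v hv => D.ram_pos v hv)) D.tail_pos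

end RallisDatum

/-! ## The H_chars discharge (lem:chars(b) → the frozen hypothesis, ll. 398–400) -/

/-- **Per-side H_chars discharge package** for a frozen `TorusData`: for every
character χ ∈ X (type-w characters of [T]), a Rallis datum whose inner value is the
squared norm of the theta vector θ_{φ(χ)}(χ), and the semantic bridge to the bare
`allowed` predicate.  The bridge field `allowed_of_theta` carries the residual
Def 3.2 content (disclosed composite): θ ≠ 0 makes the theta space π ≠ 0, and the
constituents lie in 𝒜^{1,0} by AX3 (generators of archimedean type J⁺⊗1, the
lem:arch(a)-isotypic φ_b) + AX1b(d) (generated-by ⇒ all constituents, ll. 632–635;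
plan A#6); the `w` of this package is the `w` of `D.Pw`/`D.wOccurs` (x1 coherence
pin — one w per side, [PerL] l. 398 resp. l. 402). -/
structure CharsDischarge {H HG CG G SK SigIdx SigIdxG : Type*}
    [NormedAddCommGroup H] [InnerProductSpace ℂ H] [CompleteSpace H]
    [NormedAddCommGroup HG] [InnerProductSpace ℂ HG] [CompleteSpace HG]
    [NormedAddCommGroup CG] [NormedSpace ℂ CG]
    [Group G] [TopologicalSpace G] [TopologicalSpace SK]
    {C : IsolationCore H HG CG G SK SigIdx SigIdxG} (D : TorusData C) (V : Type) where
  /-- the Rallis chain for (one line datum of) the pair behind χ. -/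
  rallis : D.X → RallisDatum V
  /-- the theta vector θ_φ(χ′) ∈ L²([G_U]) whose inner product AX7 computes. -/
  θvec : D.X → HG
  /-- AX7's left side: the datum's inner value is ‖θ‖² (l. 597, 631–632). -/
  innerSelf_eq : ∀ χ, (rallis χ).innerSelf = ‖θvec χ‖ ^ 2
  /-- BRIDGE (semantic, D1 + AX3 + AX1b(d), disclosed composite): a nonzero theta
  vector for χ makes χ arise from an allowed pair — Def 3.2's two clauses for the
  constructed data (ll. 632–635 with l. 269–279). -/
  allowed_of_theta : ∀ χ : D.X, θvec χ ≠ 0 → D.allowed χ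

namespace CharsDischarge

variable {H HG CG G SK SigIdx SigIdxG : Type*}
variable [NormedAddCommGroup H] [InnerProductSpace ℂ H] [CompleteSpace H]
variable [NormedAddCommGroup HG] [InnerProductSpace ℂ HG] [CompleteSpace HG]
variable [NormedAddCommGroup CG] [NormedSpace ℂ CG]
variable [Group G] [TopologicalSpace G] [TopologicalSpace SK]
variable {C : IsolationCore H HG CG G SK SigIdx SigIdxG} {D : TorusData C} {V : Type}

/-- **lem:chars(b), nonvanishing** (l. 631–632): θ_φ(χ′) ≠ 0 — hence π_i ≠ 0. -/
theorem θvec_ne_zero (P : CharsDischarge D V) (χ : D.X) : P.θvec χ ≠ 0 := by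
  intro h0
  have h := P.innerSelf_eq χ
  rw [h0, norm_zero] at h
  have hpos := (P.rallis χ).innerSelf_pos
  rw [h] at hpos
  norm_num at hpos

/-- **The H_chars discharge** ([PerL] ll. 398–400, 441–442): every character of [T]
with χ_∞ = w arises from an allowed pair — the hypothesis shape consumed verbatim by
the frozen `IsolationSetting.H_chars12/34`. -/
theorem H_chars (P : CharsDischarge D V) : ∀ χ : D.X, D.allowed χ := fun χ =>
  P.allowed_of_theta χ (P.θvec_ne_zero χ)

end CharsDischarge

end C4
end Perl34
end Summit.HodgeConjecture.CorCM.Prior.Perl34File
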